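import Literature.MathematicalPhysics.QuantumLattice.HubbardHubbardModelPairDecayProofs
import Literature.MathematicalPhysics.QuantumLattice.FermionOperatorsProofs
import HarnessLib

/-!
# Koma–Tasaki's a priori bound with the sharp hopping norm `‖c†_u c_v + c†_v c_u‖ ≤ 1`

Trunk T-QLATTICE (family `hubbard`; consumers: the Koma–Tasaki pair-decay bounds of
`HubbardHubbardModelPairDecayProofs.lean` and the cell file
`Summits/HubbardSuperconductivity/HubbardLadder/Bounds/PairCorrelationEtaLineDipole.lean`).

Koma–Tasaki (PRL 68 (1992) 3248, first inequality of eq. (11)) bound the Hermitian part `U` of the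
gauge-transformed hopping term by `‖U‖ ≤ Σ_{x,y} |t_{xy}| (cosh(φ_x - φ_y) - 1)` (sum over ORDERED
pairs), "where we have used `‖c†_{xσ} c_{yσ} + c†_{yσ} c_{xσ}‖ = 1`". The tree's
`norm_hoppingPerturbation_le` (`HubbardGaugeBound.lean`) counts `‖c†c + h.c.‖` as `2`
(`‖c†_{uσ} c_{vσ}‖ ≤ 1` twice) and is therefore off by a factor `2` in the exponent of the a priori
bound `norm_thermalCorr_pair_le_exp`. This file supplies the printed constant:

* `hopping_mul_self` — for distinct orbitals `a ≠ b`, `(c†_a c_b + c†_b c_a)² = n_a + n_b - 2 n_a n_b`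
  (CAR algebra; the right-hand side is the diagonal `0/1` matrix `[a ∈ s] xor [b ∈ s]`);
* `norm_hopping_le_one` — `‖c†_a c_b + c†_b c_a‖ ≤ 1` in operator norm (C⋆-identity);
* `norm_hoppingForm_le_of_symm` — for symmetric bond weights, `‖T(w)‖ ≤ Σ_u Σ_v [u ∼ v] |w(u,v)|`
  (half of `norm_hoppingForm_le`);
* `norm_hoppingPerturbation_le_sharp` — `‖V_φ‖ ≤ |t| Σ_u Σ_v [u ∼ v] (cosh(φ_u - φ_v) - 1)`,
  Koma–Tasaki's eq. (11) as printed;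
* `norm_thermalCorr_pair_le_exp_sharp` — the a priori bound
  `|⟨c†_{x↑} c†_{x↓} c_{y↓} c_{y↑}⟩_β| ≤ e^{-2(φ_x - φ_y)} exp[β |t| Σ_u Σ_v [u ∼ v] (cosh(φ_u - φ_v) - 1)]`
  for every real site function `φ` (eqs. (6)–(12) before the choice of `φ`), i.e.
  `norm_thermalCorr_pair_le_exp` with the factor `2` removed.

Sources: T. Koma, H. Tasaki, PRL 68 (1992) 3248 (= arXiv:cond-mat/9709068), eqs. (6)–(12);
O. A. McBryan, T. Spencer, Commun. Math. Phys. 53 (1977) 299.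

## Mathlib search

Mathlib has no fermionic Fock space; the concrete matrix model of the prelude is reused
(`annihilation`, `creation`, `numberAt`, `hopping`, the CAR `annihilation_mul_creation`,
`creation_mul_self`, `annihilation_anticommute_holds`, `number_mul_creation_of_ne`,
`numberAt_eq_diagonal`, `numberAt_commute`). Matrix API: `Matrix.l2_opNorm_conjTranspose_mul_self`,
`Matrix.l2_opNorm_diagonal`. The assembly `norm_gibbsState_le_of_gauge` is the tree's.

## Design notes

No statement of the prelude is changed; the sharp lemmas are stated next to the existing ones with
the suffix `_sharp` / `_of_symm`, so that both constants remain available to consumers.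
-/

noncomputable section

namespace Literature.MathematicalPhysics.QuantumLattice

open Matrix Finset NormedSpace
open scoped Matrix.Norms.L2Operator ComplexOrder

/-! ### The symmetric hopping operator between two orbitals -/

section Hopping

variable {ι : Type*} [LinearOrder ι] [Fintype ι]

/-- Pauli principle for annihilation operators: `c_i c_i = 0`.
Essler et al. (2005) §2.1, eq. (2.2a). [cite: EsslerEtAl2005, §2.1 eq. (2.2a)] -/
theorem annihilation_mul_self (i : ι) :
    (annihilation i : Matrix (Finset ι) (Finset ι) ℂ) * annihilation i = 0 := by
  have h : (2 : ℂ) • ((annihilation i : Matrix (Finset ι) (Finset ι) ℂ) * annihilation i) = 0 := by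
    rw [two_smul]; exact annihilation_anticommute_holds i i
  exact (smul_eq_zero.1 h).resolve_left two_ne_zero

/-- **The square of the symmetric hopping operator.** For distinct orbitals `a ≠ b`,
`(c†_a c_b + c†_b c_a)² = n_a + n_b - 2 n_a n_b` (the cross terms `c†_a c_b c†_a c_b` vanish by
the Pauli principle, and `c†_a c_b c†_b c_a = c†_a (1 - n_b) c_a = n_a - n_a n_b`).
Koma–Tasaki, PRL 68 (1992) 3248, remark after eq. (11) (the computation behind
`‖c†_{xσ} c_{yσ} + c†_{yσ} c_{xσ}‖ = 1`). [cite: KomaTasakiPRL1992, eq. (11) remark] -/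
theorem hopping_mul_self {a b : ι} (hab : a ≠ b) :
    (hopping a b : Matrix (Finset ι) (Finset ι) ℂ) * hopping a b =
      numberAt a + numberAt b - (2 : ℂ) • (numberAt a * numberAt b) := by
  -- the CAR facts used
  have f1 : (annihilation b : Matrix (Finset ι) (Finset ι) ℂ) * creation a =
      -(creation a * annihilation b) := by
    rw [annihilation_mul_creation, if_neg (fun h => hab h.symm), zero_sub]
  have f2 : (annihilation a : Matrix (Finset ι) (Finset ι) ℂ) * creation b =
      -(creation b * annihilation a) := by
    rw [annihilation_mul_creation, if_neg hab, zero_sub]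
  have f3 : (annihilation b : Matrix (Finset ι) (Finset ι) ℂ) * creation b = 1 - numberAt b := by
    rw [annihilation_mul_creation, if_pos rfl, numberAt]
  have f4 : (annihilation a : Matrix (Finset ι) (Finset ι) ℂ) * creation a = 1 - numberAt a := by
    rw [annihilation_mul_creation, if_pos rfl, numberAt]
  have hna : (creation b : Matrix (Finset ι) (Finset ι) ℂ) * numberAt a =
      numberAt a * creation b := by
    rw [numberAt]; exact (number_mul_creation_of_ne hab).symm
  have hnb : (creation a : Matrix (Finset ι) (Finset ι) ℂ) * numberAt b =
      numberAt b * creation a := by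
    rw [numberAt]; exact (number_mul_creation_of_ne (Ne.symm hab)).symm
  have hcomm : (numberAt b : Matrix (Finset ι) (Finset ι) ℂ) * numberAt a = numberAt a * numberAt b :=
    (numberAt_commute b a).eq
  -- the four products
  have t1 : (creation a : Matrix (Finset ι) (Finset ι) ℂ) * annihilation b *
      (creation a * annihilation b) = 0 := by
    calc (creation a : Matrix (Finset ι) (Finset ι) ℂ) * annihilation b * (creation a * annihilation b)
        = creation a * (annihilation b * creation a) * annihilation b := by noncomm_ring
      _ = 0 := by
          rw [f1, Matrix.mul_neg, Matrix.neg_mul, ← Matrix.mul_assoc, creation_mul_self,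
            Matrix.zero_mul, Matrix.zero_mul, neg_zero]
  have t4 : (creation b : Matrix (Finset ι) (Finset ι) ℂ) * annihilation a *
      (creation b * annihilation a) = 0 := by
    calc (creation b : Matrix (Finset ι) (Finset ι) ℂ) * annihilation a * (creation b * annihilation a)
        = creation b * (annihilation a * creation b) * annihilation a := by noncomm_ring
      _ = 0 := by
          rw [f2, Matrix.mul_neg, Matrix.neg_mul, ← Matrix.mul_assoc, creation_mul_self,
            Matrix.zero_mul, Matrix.zero_mul, neg_zero]
  have t2 : (creation a : Matrix (Finset ι) (Finset ι) ℂ) * annihilation b *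
      (creation b * annihilation a) = numberAt a - numberAt a * numberAt b := by
    calc (creation a : Matrix (Finset ι) (Finset ι) ℂ) * annihilation b * (creation b * annihilation a)
        = creation a * (annihilation b * creation b) * annihilation a := by noncomm_ring
      _ = creation a * annihilation a - creation a * numberAt b * annihilation a := by
          rw [f3, Matrix.mul_sub, Matrix.mul_one, Matrix.sub_mul]
      _ = numberAt a - numberAt a * numberAt b := by
          rw [hnb, Matrix.mul_assoc, ← numberAt, hcomm]
  have t3 : (creation b : Matrix (Finset ι) (Finset ι) ℂ) * annihilation a *
      (creation a * annihilation b) = numberAt b - numberAt a * numberAt b := by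
    calc (creation b : Matrix (Finset ι) (Finset ι) ℂ) * annihilation a * (creation a * annihilation b)
        = creation b * (annihilation a * creation a) * annihilation b := by noncomm_ring
      _ = creation b * annihilation b - creation b * numberAt a * annihilation b := by
          rw [f4, Matrix.mul_sub, Matrix.mul_one, Matrix.sub_mul]
      _ = numberAt b - numberAt a * numberAt b := by
          rw [hna, Matrix.mul_assoc, ← numberAt]
  rw [hopping, Matrix.add_mul, Matrix.mul_add, Matrix.mul_add, t1, t2, t3, t4, zero_add, add_zero,
    two_smul]
  abel

/-- The symmetric hopping operator is Hermitian: `(c†_a c_b + c†_b c_a)ᴴ = c†_a c_b + c†_b c_a`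
(the "h.c." of the hopping term). Koma–Tasaki, PRL 68 (1992) 3248, eq. (1).
[cite: KomaTasakiPRL1992, eq. (1)] -/
theorem hopping_conjTranspose (a b : ι) :
    (hopping a b : Matrix (Finset ι) (Finset ι) ℂ)ᴴ = hopping a b := by
  rw [hopping, conjTranspose_add, conjTranspose_mul, conjTranspose_mul, creation_conjTranspose,
    creation_conjTranspose, annihilation_conjTranspose, annihilation_conjTranspose, add_comm]

/-- **Koma–Tasaki's `‖c†_{xσ} c_{yσ} + c†_{yσ} c_{xσ}‖ = 1`** (the inequality `≤ 1`, which is what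
eq. (11) uses): for distinct orbitals the symmetric hopping operator has operator norm at most `1`
(`‖X‖² = ‖Xᴴ X‖ = ‖n_a + n_b - 2 n_a n_b‖ ≤ 1`, a diagonal `0/1` matrix).
Koma–Tasaki, PRL 68 (1992) 3248, remark after eq. (11). [cite: KomaTasakiPRL1992, eq. (11) remark] -/
theorem norm_hopping_le_one {a b : ι} (hab : a ≠ b) :
    ‖(hopping a b : Matrix (Finset ι) (Finset ι) ℂ)‖ ≤ 1 := by
  have hsq : (hopping a b : Matrix (Finset ι) (Finset ι) ℂ) * hopping a b =
      diagonal fun s : Finset ι =>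
        (if a ∈ s then (1 : ℂ) else 0) + (if b ∈ s then 1 else 0) -
          2 * ((if a ∈ s then 1 else 0) * (if b ∈ s then 1 else 0)) := by
    rw [hopping_mul_self hab, numberAt_eq_diagonal, numberAt_eq_diagonal, diagonal_mul_diagonal,
      diagonal_add]
    ext s s'
    by_cases h : s = s'
    · subst h
      simp [smul_eq_mul]
    · simp [h]
  have hn : ‖(hopping a b : Matrix (Finset ι) (Finset ι) ℂ) * hopping a b‖ ≤ 1 := by
    rw [hsq, l2_opNorm_diagonal, pi_norm_le_iff_of_nonneg zero_le_one]
    intro s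
    split_ifs <;> norm_num
  have hsq' : ‖(hopping a b : Matrix (Finset ι) (Finset ι) ℂ)‖ *
      ‖(hopping a b : Matrix (Finset ι) (Finset ι) ℂ)‖ ≤ 1 := by
    rw [← l2_opNorm_conjTranspose_mul_self, hopping_conjTranspose]
    exact hn
  nlinarith [norm_nonneg (hopping a b : Matrix (Finset ι) (Finset ι) ℂ)]

end Hopping

/-! ### Hopping operators with symmetric weights -/

section Hamiltonian

variable {Λ : Type*} [LinearOrder Λ] [Fintype Λ] (G : SimpleGraph Λ) [DecidableRel G.Adj]

/-- Symmetrisation of a hopping operator with symmetric bond weights: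
`2 T(w) = Σ_u Σ_v Σ_σ [u ∼ v] w(u,v) (c†_{uσ} c_{vσ} + c†_{vσ} c_{uσ})` — the hopping term of
Koma–Tasaki's eq. (1) written with "h.c." over ordered pairs.
Koma–Tasaki, PRL 68 (1992) 3248, eq. (1). [cite: KomaTasakiPRL1992, eq. (1)] -/
theorem two_smul_hoppingForm_eq {w : Λ → Λ → ℝ} (hw : ∀ u v, w u v = w v u) :
    (2 : ℂ) • hoppingForm G w =
      ∑ u : Λ, ∑ v : Λ, ∑ σ : Fin 2,
        if G.Adj u v then ((w u v : ℝ) : ℂ) • hopping (orb u σ) (orb v σ) else 0 := by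
  rw [two_smul]
  conv_lhs => arg 2; rw [hoppingForm_eq, Finset.sum_comm]
  rw [hoppingForm_eq, ← Finset.sum_add_distrib]
  refine Finset.sum_congr rfl fun u _ => ?_
  rw [← Finset.sum_add_distrib]
  refine Finset.sum_congr rfl fun v _ => ?_
  rw [← Finset.sum_add_distrib]
  refine Finset.sum_congr rfl fun σ _ => ?_
  by_cases h : G.Adj u v
  · rw [if_pos h, if_pos (G.adj_symm h), if_pos h, hw v u, hopping, smul_add]
  · rw [if_neg h, if_neg (fun h' => h (G.adj_symm h')), if_neg h, add_zero]

/-- **Sharp norm bound for hopping operators with symmetric weights**: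
`‖T(w)‖ ≤ Σ_u Σ_v [u ∼ v] |w(u, v)|` (ordered pairs; `‖c†_{uσ} c_{vσ} + c†_{vσ} c_{uσ}‖ ≤ 1`, two
spin values, each unordered bond counted twice) — half of `norm_hoppingForm_le`.
Koma–Tasaki, PRL 68 (1992) 3248, first bound of eq. (11).
[cite: KomaTasakiPRL1992, eq. (11), first inequality] -/
theorem norm_hoppingForm_le_of_symm {w : Λ → Λ → ℝ} (hw : ∀ u v, w u v = w v u) :
    ‖hoppingForm G w‖ ≤ ∑ u : Λ, ∑ v : Λ, if G.Adj u v then |w u v| else 0 := by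
  have hterm : ∀ (u v : Λ) (σ : Fin 2),
      ‖(if G.Adj u v then ((w u v : ℝ) : ℂ) • hopping (orb u σ) (orb v σ) else 0 :
        Matrix (Finset (Orb Λ)) (Finset (Orb Λ)) ℂ)‖ ≤ if G.Adj u v then |w u v| else 0 := by
    intro u v σ
    split_ifs with h
    · have hne : orb u σ ≠ orb v σ := fun he => G.ne_of_adj h (orb_eq_orb_iff.1 he).1
      rw [norm_smul, Complex.norm_real, Real.norm_eq_abs]
      exact mul_le_of_le_one_right (abs_nonneg _) (norm_hopping_le_one hne)
    · rw [norm_zero]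
  have h2 : ‖(2 : ℂ) • hoppingForm G w‖ ≤
      2 * ∑ u : Λ, ∑ v : Λ, if G.Adj u v then |w u v| else 0 := by
    rw [two_smul_hoppingForm_eq G hw]
    refine (norm_sum_le _ _).trans ?_
    rw [Finset.mul_sum]
    refine Finset.sum_le_sum fun u _ => (norm_sum_le _ _).trans ?_
    rw [Finset.mul_sum]
    refine Finset.sum_le_sum fun v _ => (norm_sum_le _ _).trans ?_
    calc ∑ σ : Fin 2, ‖(if G.Adj u v then ((w u v : ℝ) : ℂ) • hopping (orb u σ) (orb v σ) else 0 :
            Matrix (Finset (Orb Λ)) (Finset (Orb Λ)) ℂ)‖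
        ≤ ∑ _σ : Fin 2, (if G.Adj u v then |w u v| else 0) :=
          Finset.sum_le_sum fun σ _ => hterm u v σ
      _ = 2 * (if G.Adj u v then |w u v| else 0) := by simp [two_mul]
  have hn2 : ‖(2 : ℂ) • hoppingForm G w‖ = 2 * ‖hoppingForm G w‖ := by
    rw [norm_smul]; norm_num
  rw [hn2] at h2
  linarith

/-- **Koma–Tasaki eq. (11), as printed**: the perturbation `V_φ = -t T(cosh(φ_u - φ_v) - 1)` obeys
`‖V_φ‖ ≤ |t| Σ_u Σ_v [u ∼ v] (cosh(φ_u - φ_v) - 1)` (ordered pairs; no factor `2`).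
Koma–Tasaki, PRL 68 (1992) 3248, first bound of eq. (11).
[cite: KomaTasakiPRL1992, eq. (11), first inequality] -/
theorem norm_hoppingPerturbation_le_sharp (φ : Λ → ℝ) (t : ℝ) :
    ‖-(t : ℂ) • hoppingForm G (fun u v => Real.cosh (φ u - φ v) - 1)‖ ≤
      |t| * ∑ u : Λ, ∑ v : Λ, if G.Adj u v then (Real.cosh (φ u - φ v) - 1) else 0 := by
  rw [norm_smul, norm_neg, Complex.norm_real, Real.norm_eq_abs]
  refine mul_le_mul_of_nonneg_left ((norm_hoppingForm_le_of_symm G ?_).trans (le_of_eq ?_))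
    (abs_nonneg t)
  · intro u v
    rw [← Real.cosh_neg, neg_sub]
  · refine Finset.sum_congr rfl fun u _ => Finset.sum_congr rfl fun v _ => ?_
    split_ifs
    · rw [abs_of_nonneg (sub_nonneg.2 (Real.one_le_cosh _))]
    · rfl

/-- **Koma–Tasaki's a priori bound with the printed constant** (eqs. (6)–(10), (12) before the
choice of `φ`): for the grand-canonical Hubbard model on a finite graph, every real site function
`φ` and `β ≥ 0`,
`|⟨c†_{x↑} c†_{x↓} c_{y↓} c_{y↑}⟩_β| ≤ e^{-2(φ_x - φ_y)} exp[β |t| Σ_u Σ_v [u ∼ v] (cosh(φ_u - φ_v) - 1)]`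
— `norm_thermalCorr_pair_le_exp` with the factor `2` of `norm_hoppingPerturbation_le` removed.
Koma–Tasaki, PRL 68 (1992) 3248, eqs. (6)–(12). [cite: KomaTasakiPRL1992, eqs. (6)–(12)] -/
theorem norm_thermalCorr_pair_le_exp_sharp (t U μ : ℝ) {β : ℝ} (hβ : 0 ≤ β) (φ : Λ → ℝ)
    (x y : Λ) :
    ‖(hamiltonianWith G t U μ).thermalCorr β (creation (orb x 0) * creation (orb x 1))
        (annihilation (orb y 1) * annihilation (orb y 0))‖ ≤
      Real.exp (-2 * (φ x - φ y)) *
        Real.exp (β * (|t| * ∑ u : Λ, ∑ v : Λ,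
          if G.Adj u v then (Real.cosh (φ u - φ v) - 1) else 0)) := by
  set H : Matrix (Finset (Orb Λ)) (Finset (Orb Λ)) ℂ := hamiltonianWith G t U μ with hH_def
  set A : Matrix (Finset (Orb Λ)) (Finset (Orb Λ)) ℂ :=
    creation (orb x 0) * creation (orb x 1) * (annihilation (orb y 1) * annihilation (orb y 0))
    with hA_def
  set V : Matrix (Finset (Orb Λ)) (Finset (Orb Λ)) ℂ :=
    -(t : ℂ) • hoppingForm G (fun u v => Real.cosh (φ u - φ v) - 1) with hV_def
  set c : ℝ := |t| * ∑ u : Λ, ∑ v : Λ,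
    if G.Adj u v then (Real.cosh (φ u - φ v) - 1) else 0 with hc_def
  have hH : H.IsHermitian := isHermitian_hamiltonianWith G t U μ
  have hD : IsUnit (siteGauge φ) := isUnit_siteGauge φ
  have hA : siteGauge φ * A * (siteGauge φ)⁻¹ =
      ((Real.exp (-2 * (φ x - φ y)) : ℝ) : ℂ) • A := by
    rw [siteGauge_inv]
    exact siteGauge_mul_pair_mul φ x y
  have hV : siteGauge φ * H * (siteGauge φ)⁻¹ + (siteGauge φ * H * (siteGauge φ)⁻¹)ᴴ =
      (2 : ℂ) • (H + V) := by
    rw [siteGauge_inv]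
    exact siteGauge_conj_hamiltonianWith_add_conjTranspose G φ t U μ
  have hc : ‖V‖ ≤ c := norm_hoppingPerturbation_le_sharp G φ t
  have h := norm_gibbsState_le_of_gauge hH hD hA hV hc hβ
  have hκ : ‖((Real.exp (-2 * (φ x - φ y)) : ℝ) : ℂ)‖ = Real.exp (-2 * (φ x - φ y)) := by
    rw [Complex.norm_real, Real.norm_of_nonneg (Real.exp_pos _).le]
  have hthermal : H.thermalCorr β (creation (orb x 0) * creation (orb x 1))
      (annihilation (orb y 1) * annihilation (orb y 0)) = gibbsState β H A := rfl
  rw [hthermal]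
  calc ‖gibbsState β H A‖
      ≤ ‖((Real.exp (-2 * (φ x - φ y)) : ℝ) : ℂ)‖ * ‖A‖ * Real.exp (β * c) := h
    _ ≤ ‖((Real.exp (-2 * (φ x - φ y)) : ℝ) : ℂ)‖ * 1 * Real.exp (β * c) := by
        gcongr
        exact norm_pair_le_one x y
    _ = Real.exp (-2 * (φ x - φ y)) * Real.exp (β * c) := by rw [hκ, mul_one]

end Hamiltonian

end Literature.MathematicalPhysics.QuantumLattice
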